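import Summits.RiemannHypothesis.RiemannHypothesis.Theorems.SuzukiWindowsDoorDecayExponentSmallWindow
import Summits.RiemannHypothesis.RiemannHypothesis.Theorems.SuzukiWindowsDoorKernelMonotone

/-!
# SuzukiWindowsDoorDecayExponentDefect — the small-window DEFECT of the θ-flow decay law, `lim_{t→0⁺}(κ_op − 2ε) = 2 log(θ₀‖A_{θ₀}‖/‖A_{θ₀+1}‖) + 2γ − 2μ₁`, grows without bound in `θ₀` (column DBR; RH-FREE)

LINE 1 — LABEL: RH-FREE asymptotic theorems (t → 0⁺) about the explicit operator family `𝖪_θ[t]` and Weil's ground energy;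
bears_on: LADDER-RH B-D(b) → B-P(P2)/B-P(P2-flow) (PROOF-OF-DATA for the registered experiment EXP-R2a, TARGET-v10 §E.1,
question Q2 «is the decay law sharp as θ → ∞?» in its `t → 0⁺` corner).  WHAT THIS IS NOT: no sign of `ε(t)` at a fixed `t`,
no window certified, nothing about `ζ`'s zeros; the `∀ t` antitone level stays RH-EQUIVALENT and unclaimed; nothing here
bears on the truth of RH.

For CONSECUTIVE integers `θ₀ = k+1 ≥ 2`, `θ₁ = k+2`, families of bounded realisations `A₀ t`, `A₁ t` of `𝖪_{θ₀}[t]`,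
`𝖪_{θ₁}[t]`, realisations `B₀`, `B₁` of the onset operators (kernels `(u+v)₊^k`, `(u+v)₊^{k+1}` on `L²(−1,1)`), and every
`μ₁, C, a₀` admissible in Suzuki's small-window asymptotic of `ε` (tree: `Suzuki2026_thm_1_4_asymptotic_holds`):

* **`tendsto_defect_consecutive`**: `κ_op(t;θ₀,θ₀+1) − 2ε(t) → 2 log(θ₀‖B₀‖/‖B₁‖) + 2γ − 2μ₁` (`c_{θ₀}/c_{θ₀+1} = θ₀/(2π)`
  in `SuzukiWindowsDoorDecayExponentSmallWindow.tendsto_decayExponent_sub_two_mul_weilGroundEnergy`);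
* **`defect_limit_ge`**: that limit is `≥ 2 log(θ₀/2) + 2γ − 2μ₁`, because `‖A_{θ+1}‖ ≤ 2‖A_θ‖` (eng-3 g4,
  `SuzukiWindowsDoorKernelMonotone.opNorm_onsetOp_succ_le_two_mul`) — so the small-window defect of the decay law
  `κ ≥ 2ε` tends to `+∞` with `θ₀`: in the `t → 0⁺` corner the law is NOT saturated at large `θ` beyond leading order, and
  any «Weil-extremal» behaviour of the window operators must be sought at SMALL `θ` — the direction of DATA.md §EXP-R2a's
  readings Q1/Q2 (κ_op increasing in θ; κ/2ε nearest 1 for the smallest θ-pairs), here as a theorem in the small-window limit.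
  (`defect_limit_nonneg`: the limit is `≥ 0`, i.e. `μ₁ ≤ γ + log(θ₀‖B₀‖/‖B₁‖)` for every `θ₀` — the family of bounds behind
  `…SmallWindow.mu_one_le`.)

References: [Su20] M. Suzuki, ASPM 84 (2020) = arXiv:1907.07302; [Su26] M. Suzuki, Thm 1.4; rh-dbr TARGET-v10 §E.1;
DATA.md §EXP-R2a, §ET1f-lite, §ET1i.
-/

noncomputable section

-- D-0017: `Summit.<S>.<S>.…` is the designed namespace of a single-problem summit.
set_option linter.dupNamespace false

open MeasureTheory Set Filter Topology

namespace Summit.RiemannHypothesis.RiemannHypothesis.Theorems.SuzukiWindowsDoorDecayExponentDefect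

open Literature.NumberTheory.LFunctions Literature.Analysis.OperatorTheory
open Summit.RiemannHypothesis.RiemannHypothesis.Theorems.SuzukiWindowsDoorDecayExponentSmallWindow
open Summit.RiemannHypothesis.RiemannHypothesis.Theorems.SuzukiWindowsDoorKernelMonotone (opNorm_onsetOp_succ_le_two_mul)

variable {k : ℕ}
  {A₀ A₁ : ∀ t : ℝ, Lp ℝ 2 (volume.restrict (Ioo (-t) t)) →L[ℝ] Lp ℝ 2 (volume.restrict (Ioo (-t) t))}
  {B₀ B₁ : Lp ℝ 2 (volume.restrict (Ioo (-1 : ℝ) 1)) →L[ℝ] Lp ℝ 2 (volume.restrict (Ioo (-1 : ℝ) 1))}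

/-- `c_{k+1}‖B₀‖ / (c_{k+2}‖B₁‖) = (k+1)‖B₀‖/(2π‖B₁‖)` (`c_θ = (2π)^θ/Γ(θ)`). -/
theorem leading_ratio_consecutive (k : ℕ) (x y : ℝ) (hy : y ≠ 0) :
    ((2 * Real.pi) ^ (k + 1) / (k.factorial : ℝ) * x) / ((2 * Real.pi) ^ (k + 1 + 1) / ((k + 1).factorial : ℝ) * y) =
      ((k : ℝ) + 1) * x / (2 * Real.pi * y) := by
  have hπ : (2 * Real.pi) ≠ 0 := by positivity
  have hf : (k.factorial : ℝ) ≠ 0 := by positivity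
  rw [Nat.factorial_succ]
  push_cast
  field_simp
  ring

/-- **RH-FREE · the small-window defect of the decay law for consecutive integers**: with `θ₀ = k+1 ≥ 2`, `θ₁ = k+2`,
`κ_op(t;θ₀,θ₁) − 2ε(t) → 2 log(θ₀‖B₀‖/‖B₁‖) + 2γ − 2μ₁` as `t → 0⁺`, for every `μ₁` admissible in Suzuki's asymptotic. -/
theorem tendsto_defect_consecutive (hk : 1 ≤ k)
    (hA₀ : ∀ t φ, (A₀ t φ : ℝ → ℝ) =ᵐ[volume.restrict (Ioo (-t) t)]
      fun x => ∫ y in Ioo (-t) t, limKernel ((k : ℝ) + 1) (x + y) * φ y)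
    (hA₁ : ∀ t φ, (A₁ t φ : ℝ → ℝ) =ᵐ[volume.restrict (Ioo (-t) t)]
      fun x => ∫ y in Ioo (-t) t, limKernel ((k : ℝ) + 2) (x + y) * φ y)
    (hB₀ : ∀ φ, (B₀ φ : ℝ → ℝ) =ᵐ[volume.restrict (Ioo (-1 : ℝ) 1)]
      fun u => ∫ v in Ioo (-1 : ℝ) 1, (max (u + v) 0) ^ k * φ v)
    (hB₁ : ∀ φ, (B₁ φ : ℝ → ℝ) =ᵐ[volume.restrict (Ioo (-1 : ℝ) 1)]
      fun u => ∫ v in Ioo (-1 : ℝ) 1, (max (u + v) 0) ^ (k + 1) * φ v)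
    {μ₁ C a₀ : ℝ} (ha₀ : 0 < a₀)
    (hε : ∀ a : ℝ, 0 < a → a ≤ a₀ → |weilGroundEnergy a -
        (Real.log (1 / a) + μ₁ - Real.log (2 * Real.pi) - Real.eulerMascheroniConstant)| ≤ C * a) :
    Tendsto (fun t : ℝ => Real.log (‖A₀ t‖ ^ 2 / ‖A₁ t‖ ^ 2) / (((k : ℝ) + 2) - ((k : ℝ) + 1)) -
        2 * weilGroundEnergy t) (𝓝[>] 0)
      (𝓝 (2 * Real.log (((k : ℝ) + 1) * ‖B₀‖ / ‖B₁‖) + 2 * Real.eulerMascheroniConstant - 2 * μ₁)) := by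
  have hk1 : k < k + 1 := Nat.lt_succ_self k
  have hθ₁ : ((k : ℝ) + 2) = ((k + 1 : ℕ) : ℝ) + 1 := by push_cast; ring
  have h := tendsto_decayExponent_sub_two_mul_weilGroundEnergy (A₀ := A₀) (A₁ := A₁) (θ₀ := (k : ℝ) + 1)
    (θ₁ := (k : ℝ) + 2) hk hk1 rfl hθ₁ hA₀ hA₁ hB₀ hB₁ ha₀ hε
  have hB₁pos : 0 < ‖B₁‖ := opNorm_onsetOp_pos (by omega) hB₁
  have hB₀pos : 0 < ‖B₀‖ := opNorm_onsetOp_pos hk hB₀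
  have hπ : 0 < Real.pi := Real.pi_pos
  rw [leading_ratio_consecutive k ‖B₀‖ ‖B₁‖ hB₁pos.ne'] at h
  refine (h.congr' (Eventually.of_forall fun t => rfl)).trans ?_
  -- the two limits coincide
  rw [show ((k : ℝ) + 2) - ((k : ℝ) + 1) = 1 by ring, div_one,
    show ((k : ℝ) + 1) * ‖B₀‖ / (2 * Real.pi * ‖B₁‖) = (((k : ℝ) + 1) * ‖B₀‖ / ‖B₁‖) / (2 * Real.pi) by
      field_simp,
    Real.log_div (by positivity) (by positivity)]
  ring_nf
  exact le_rfl

/-- The onset realisations compare: `‖B₁‖ ≤ 2‖B₀‖` (eng-3 g4's `opNorm_onsetOp_succ_le_two_mul`, natural powers). -/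
theorem opNorm_onsetOp_succ_le (k : ℕ)
    (hB₀ : ∀ φ, (B₀ φ : ℝ → ℝ) =ᵐ[volume.restrict (Ioo (-1 : ℝ) 1)]
      fun u => ∫ v in Ioo (-1 : ℝ) 1, (max (u + v) 0) ^ k * φ v)
    (hB₁ : ∀ φ, (B₁ φ : ℝ → ℝ) =ᵐ[volume.restrict (Ioo (-1 : ℝ) 1)]
      fun u => ∫ v in Ioo (-1 : ℝ) 1, (max (u + v) 0) ^ (k + 1) * φ v)
    (hk : 1 ≤ k) : ‖B₁‖ ≤ 2 * ‖B₀‖ := by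
  have hθ : (1 : ℝ) < (k : ℝ) + 1 := by
    have : (1 : ℝ) ≤ k := by exact_mod_cast hk
    linarith
  refine opNorm_onsetOp_succ_le_two_mul (θ := (k : ℝ) + 1) hθ (fun φ => ?_) (fun φ => ?_)
  · refine (hB₁ φ).trans (Eventually.of_forall fun u => ?_)
    simp only
    refine integral_congr_ae (Eventually.of_forall fun v => ?_)
    simp only
    rw [show ((k : ℝ) + 1) = ((k + 1 : ℕ) : ℝ) by push_cast; ring, Real.rpow_natCast]
  · refine (hB₀ φ).trans (Eventually.of_forall fun u => ?_)
    simp only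
    refine integral_congr_ae (Eventually.of_forall fun v => ?_)
    simp only
    rw [show ((k : ℝ) + 1 - 1) = ((k : ℕ) : ℝ) by ring, Real.rpow_natCast]

/-- **RH-FREE · THE DEFECT GROWS WITHOUT BOUND IN `θ₀`**: the small-window limit of `κ_op(t;θ₀,θ₀+1) − 2ε(t)` is
`≥ 2 log(θ₀/2) + 2γ − 2μ₁` (`θ₀ = k+1 ≥ 2`; `‖A_{θ₀+1}‖ ≤ 2‖A_{θ₀}‖`).  So in the `t → 0⁺` corner the decay law
`κ ≥ 2ε` is saturated only to leading order `2 log(1/t)`; its `O(1)` defect diverges like `2 log θ₀` — no saturation at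
large `θ` (EXP-R2a Q2's reading, here a theorem in the small-window limit).  Nothing here bears on RH. -/
theorem defect_limit_ge (hk : 1 ≤ k)
    (hB₀ : ∀ φ, (B₀ φ : ℝ → ℝ) =ᵐ[volume.restrict (Ioo (-1 : ℝ) 1)]
      fun u => ∫ v in Ioo (-1 : ℝ) 1, (max (u + v) 0) ^ k * φ v)
    (hB₁ : ∀ φ, (B₁ φ : ℝ → ℝ) =ᵐ[volume.restrict (Ioo (-1 : ℝ) 1)]
      fun u => ∫ v in Ioo (-1 : ℝ) 1, (max (u + v) 0) ^ (k + 1) * φ v) (μ₁ : ℝ) :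
    2 * Real.log (((k : ℝ) + 1) / 2) + 2 * Real.eulerMascheroniConstant - 2 * μ₁ ≤
      2 * Real.log (((k : ℝ) + 1) * ‖B₀‖ / ‖B₁‖) + 2 * Real.eulerMascheroniConstant - 2 * μ₁ := by
  have hB₁pos : 0 < ‖B₁‖ := opNorm_onsetOp_pos (by omega) hB₁
  have hB₀pos : 0 < ‖B₀‖ := opNorm_onsetOp_pos hk hB₀
  have hle : ‖B₁‖ ≤ 2 * ‖B₀‖ := opNorm_onsetOp_succ_le k hB₀ hB₁ hk
  have hk0 : (0 : ℝ) ≤ k := Nat.cast_nonneg k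
  have h1 : ((k : ℝ) + 1) / 2 ≤ ((k : ℝ) + 1) * ‖B₀‖ / ‖B₁‖ := by
    rw [div_le_div_iff₀ two_pos hB₁pos]
    nlinarith
  have h2 := Real.log_le_log (by positivity) h1
  linarith

/-- RH-FREE · the defect limit is non-negative (`κ_op ≥ 2ε` for every `t > 0`), i.e. `μ₁ ≤ γ + log(θ₀‖B₀‖/‖B₁‖)` for
every `θ₀ = k+1 ≥ 2` — the family of cross-column bounds behind `SuzukiWindowsDoorDecayExponentSmallWindow.mu_one_le`. -/
theorem defect_limit_nonneg (hk : 1 ≤ k)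
    (hA₀ : ∀ t φ, (A₀ t φ : ℝ → ℝ) =ᵐ[volume.restrict (Ioo (-t) t)]
      fun x => ∫ y in Ioo (-t) t, limKernel ((k : ℝ) + 1) (x + y) * φ y)
    (hA₁ : ∀ t φ, (A₁ t φ : ℝ → ℝ) =ᵐ[volume.restrict (Ioo (-t) t)]
      fun x => ∫ y in Ioo (-t) t, limKernel ((k : ℝ) + 2) (x + y) * φ y)
    (hB₀ : ∀ φ, (B₀ φ : ℝ → ℝ) =ᵐ[volume.restrict (Ioo (-1 : ℝ) 1)]
      fun u => ∫ v in Ioo (-1 : ℝ) 1, (max (u + v) 0) ^ k * φ v)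
    (hB₁ : ∀ φ, (B₁ φ : ℝ → ℝ) =ᵐ[volume.restrict (Ioo (-1 : ℝ) 1)]
      fun u => ∫ v in Ioo (-1 : ℝ) 1, (max (u + v) 0) ^ (k + 1) * φ v)
    {μ₁ C a₀ : ℝ} (ha₀ : 0 < a₀)
    (hε : ∀ a : ℝ, 0 < a → a ≤ a₀ → |weilGroundEnergy a -
        (Real.log (1 / a) + μ₁ - Real.log (2 * Real.pi) - Real.eulerMascheroniConstant)| ≤ C * a) :
    0 ≤ 2 * Real.log (((k : ℝ) + 1) * ‖B₀‖ / ‖B₁‖) + 2 * Real.eulerMascheroniConstant - 2 * μ₁ := by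
  have hk1 : k < k + 1 := Nat.lt_succ_self k
  have hθ₁ : ((k : ℝ) + 2) = ((k + 1 : ℕ) : ℝ) + 1 := by push_cast; ring
  have h := mu_one_le (A₀ := A₀) (A₁ := A₁) (θ₀ := (k : ℝ) + 1) (θ₁ := (k : ℝ) + 2) hk hk1 rfl hθ₁
    hA₀ hA₁ hB₀ hB₁ ha₀ hε
  have hB₁pos : 0 < ‖B₁‖ := opNorm_onsetOp_pos (by omega) hB₁
  have hB₀pos : 0 < ‖B₀‖ := opNorm_onsetOp_pos hk hB₀
  have hπ : 0 < Real.pi := Real.pi_pos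
  rw [leading_ratio_consecutive k ‖B₀‖ ‖B₁‖ hB₁pos.ne', show ((k : ℝ) + 2) - ((k : ℝ) + 1) = 1 by ring, div_one,
    show ((k : ℝ) + 1) * ‖B₀‖ / (2 * Real.pi * ‖B₁‖) = (((k : ℝ) + 1) * ‖B₀‖ / ‖B₁‖) / (2 * Real.pi) by
      field_simp,
    Real.log_div (by positivity) (by positivity)] at h
  linarith

end Summit.RiemannHypothesis.RiemannHypothesis.Theorems.SuzukiWindowsDoorDecayExponentDefect

end
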